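import Literature.RepresentationTheory.CompactGroups.NormalSubgroupsFromDerivations
import HarnessLib

/-!
# Invariant subspaces of `K/K²`: complete reducibility and the structure theorem

Continuation of `NormalSubgroupsFromDerivations` (compact Hausdorff group `G`, representative
functions `R` separating points, augmentation ideal `K`, `K²`):

* **Weyl's unitarian trick**, real finite-dimensional abstract form (`exists_invariant_isCompl`): a
  right action of `G` on a finite-dimensional real vector space with continuous matrix coefficients
  admits invariant complements of invariant subspaces (average a Euclidean scalar product over the
  Haar measure of `G`, take the orthogonal complement; Bröcker–tom Dieck II (1.7));
* **complete reducibility modulo `K²`** (`exists_isConjInvariant_compl`): if every closed connected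
  normal subgroup of `G` is `⊥` or `⊤`, a conjugation-invariant `V` with `K² ≤ V ≤ K`, `V ≠ K²` has
  a conjugation-invariant partner `V₂` with `K² ≤ V₂ ≤ K`, `V + V₂ = K`, `V₂ ≠ K` (work in the
  finite-dimensional model `F₁ ≅ K/K²` supplied by `exists_finiteDimensional_sup_augIdealSq_eq`);
* the **structure theorem** (`IsConjInvariant.eq_augIdealSq_or_eq_augIdeal`): if moreover `G` is
  non-abelian, the only conjugation-invariant `V` with `K² ≤ V ≤ K` are `K²` and `K` — the Lie-free
  form of "the adjoint representation of a simple compact group is irreducible": otherwise the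
  annihilators of `V` and `V₂` generate two commuting closed connected normal subgroups, both equal
  to `G`, forcing `G` to be abelian.

Used by `Literature.MathematicalPhysics.QuantumLattice.isGroupHeatKernel_unique_up_to_scale`
(Hunt 1956, Thm 5.1 with Schur's lemma). Sources: T. Bröcker, T. tom Dieck (1985), II (1.7);
J. F. Price, *Lie Groups and Compact Groups* (1977), Thm 6.5.6; G. Hochschild (1965), Ch. XIII.
No named facts.
-/

noncomputable section

open scoped Classical
open NormedSpace Filter Topology MeasureTheory

namespace Literature.RepresentationTheory.CompactGroups

section Reducibility

variable {G : Type*} [TopologicalSpace G] [Group G] [IsTopologicalGroup G] [CompactSpace G]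

/-! ### Continuity of the conjugation orbit map -/

omit [CompactSpace G] in
/-- The orbit map `g ↦ κ_g u = u(g · g⁻¹)` is continuous into `C(G, ℝ)` (compact-open topology;
currying the continuous function `(g, x) ↦ u(g x g⁻¹)`). [folklore] -/
theorem continuous_conjTrans_apply (u : C(G, ℝ)) : Continuous fun g : G => conjTrans g u := by
  let Φ : C(G × G, ℝ) := ⟨fun p => u (p.1 * p.2 * p.1⁻¹), by fun_prop⟩
  have h : (fun g : G => conjTrans g u) = fun g => Φ.curry g := by
    funext g; ext x; simp [Φ]
  rw [h]
  exact Φ.curry.continuous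

/-! ### Weyl's unitarian trick: invariant complements for finite-dimensional real representations -/

/-- **Invariant complements (Weyl's unitarian trick, real finite-dimensional case).** Let `ρ` be a
right action of the compact group `G` on a finite-dimensional real vector space `E` by linear maps,
with continuous matrix coefficients `g ↦ L(ρ_g x)`. Then every `ρ`-invariant subspace `W₁` has a
`ρ`-invariant linear complement `W₂`: average a Euclidean scalar product over the Haar measure of
`G` and take the orthogonal complement (Bröcker–tom Dieck II (1.7)). [folklore] -/
theorem exists_invariant_isCompl {E : Type*} [AddCommGroup E] [Module ℝ E] [FiniteDimensional ℝ E]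
    (ρ : G → E →ₗ[ℝ] E) (hρ_mul : ∀ (g h : G) (x : E), ρ h (ρ g x) = ρ (g * h) x)
    (hρ_one : ∀ x : E, ρ 1 x = x)
    (hρcont : ∀ (L : E →ₗ[ℝ] ℝ) (x : E), Continuous fun g : G => L (ρ g x))
    (W₁ : Submodule ℝ E) (hW₁ : ∀ g : G, ∀ x ∈ W₁, ρ g x ∈ W₁) :
    ∃ W₂ : Submodule ℝ E, (∀ g : G, ∀ y ∈ W₂, ρ g y ∈ W₂) ∧ W₁ ⊓ W₂ = ⊥ ∧ W₁ ⊔ W₂ = ⊤ := by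
  classical
  -- a Euclidean structure on `E` and the averaged invariant form
  set n := Module.finrank ℝ E
  set e : E ≃ₗ[ℝ] (Fin n → ℝ) := (Module.finBasis ℝ E).equivFun with he
  set ip₀ : E → E → ℝ := fun x y => ∑ i, e x i * e y i with hip₀
  borelize G
  set μ : Measure G := Measure.haarMeasure ⊤ with hμ
  haveI : IsProbabilityMeasure μ := CompactGroup.isProbabilityMeasure_haarMeasure_top (G := G)
  set B : E → E → ℝ := fun x y => ∫ g, ip₀ (ρ g x) (ρ g y) ∂μ with hB
  have hcoord : ∀ i : Fin n, ∀ x : E, Continuous fun g : G => e (ρ g x) i := fun i x =>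
    hρcont ((LinearMap.proj i).comp e.toLinearMap) x
  have hint_cont : ∀ x y : E, Continuous fun g : G => ip₀ (ρ g x) (ρ g y) := fun x y => by
    simp only [hip₀]; exact continuous_finsetSum _ fun i _ => (hcoord i x).mul (hcoord i y)
  have hInt : ∀ x y : E, Integrable (fun g : G => ip₀ (ρ g x) (ρ g y)) μ := fun x y =>
    (hint_cont x y).integrable_of_hasCompactSupport (HasCompactSupport.of_compactSpace _)
  -- bilinearity and symmetry of `ip₀` and `B`
  have hip₀_add_left : ∀ x x' y : E, ip₀ (x + x') y = ip₀ x y + ip₀ x' y := fun x x' y => by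
    simp only [hip₀, map_add, Pi.add_apply, add_mul, Finset.sum_add_distrib]
  have hip₀_smul_left : ∀ (c : ℝ) (x y : E), ip₀ (c • x) y = c * ip₀ x y := fun c x y => by
    simp only [hip₀, map_smul, Pi.smul_apply, smul_eq_mul]
    rw [Finset.mul_sum]
    exact Finset.sum_congr rfl fun i _ => by ring
  have hip₀_comm : ∀ x y : E, ip₀ x y = ip₀ y x := fun x y => by
    simp only [hip₀]; exact Finset.sum_congr rfl fun i _ => mul_comm _ _
  have hB_add_left : ∀ x x' y : E, B (x + x') y = B x y + B x' y := fun x x' y => by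
    simp only [hB, map_add, hip₀_add_left]; exact integral_add (hInt x y) (hInt x' y)
  have hB_smul_left : ∀ (c : ℝ) (x y : E), B (c • x) y = c * B x y := fun c x y => by
    simp only [hB, map_smul, hip₀_smul_left]; exact integral_const_mul c _
  have hB_comm : ∀ x y : E, B x y = B y x := fun x y => by simp only [hB, hip₀_comm]
  have hB_add_right : ∀ x y y' : E, B x (y + y') = B x y + B x y' := fun x y y' => by
    rw [hB_comm, hB_add_left, hB_comm y, hB_comm y']
  have hB_smul_right : ∀ (c : ℝ) (x y : E), B x (c • y) = c * B x y := fun c x y => by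
    rw [hB_comm, hB_smul_left, hB_comm]
  -- invariance (left invariance of the Haar measure)
  have hB_inv : ∀ (k : G) (x y : E), B (ρ k x) (ρ k y) = B x y := by
    intro k x y
    simp only [hB, hρ_mul]
    exact integral_mul_left_eq_self (fun g => ip₀ (ρ g x) (ρ g y)) k
  -- positivity
  have hB_pos : ∀ x : E, x ≠ 0 → 0 < B x x := by
    intro x hx
    simp only [hB]
    have hnn : ∀ g, 0 ≤ ip₀ (ρ g x) (ρ g x) := fun g => by
      simp only [hip₀]; exact Finset.sum_nonneg fun i _ => mul_self_nonneg _
    have h1 : ip₀ (ρ 1 x) (ρ 1 x) ≠ 0 := by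
      rw [hρ_one]
      intro h0
      have hzero : ∀ i, e x i = 0 := by
        intro i
        have := (Finset.sum_eq_zero_iff_of_nonneg (fun j _ => mul_self_nonneg (e x j))).mp h0 i
          (Finset.mem_univ i)
        exact mul_self_eq_zero.mp this
      apply hx
      apply e.injective
      rw [map_zero]
      funext i; exact hzero i
    exact (hint_cont x x).integral_pos_of_hasCompactSupport_nonneg_nonzero
      (HasCompactSupport.of_compactSpace _) hnn h1
  -- the orthogonal complement
  set W₂ : Submodule ℝ E :=
    { carrier := {y | ∀ x ∈ W₁, B x y = 0}
      add_mem' := fun {y y'} hy hy' x hx => by rw [hB_add_right, hy x hx, hy' x hx, add_zero]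
      zero_mem' := fun x hx => by
        have := hB_smul_right 0 x 0; rw [zero_smul, zero_mul] at this; exact this
      smul_mem' := fun c y hy x hx => by rw [hB_smul_right, hy x hx, mul_zero] } with hW₂
  have hW₂inv : ∀ (g : G), ∀ y ∈ W₂, ρ g y ∈ W₂ := by
    intro g y hy x hx
    have h1 : x = ρ g (ρ g⁻¹ x) := by rw [hρ_mul, inv_mul_cancel, hρ_one]
    rw [h1, hB_inv]
    exact hy _ (hW₁ g⁻¹ x hx)
  have hW₁₂ : W₁ ⊓ W₂ = ⊥ := by
    rw [Submodule.eq_bot_iff]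
    rintro y ⟨hy₁, hy₂⟩
    by_contra hy0
    have := hB_pos y hy0
    rw [hy₂ y hy₁] at this
    exact lt_irrefl _ this
  have hW₁₂top : W₁ ⊔ W₂ = ⊤ := by
    -- dimension count through `Ψ : E → Dual W₁`, `y ↦ B(·, y)`, with `ker Ψ = W₂`
    set Ψ : E →ₗ[ℝ] Module.Dual ℝ W₁ :=
      { toFun := fun y =>
          { toFun := fun x => B x y
            map_add' := fun x x' => hB_add_left _ _ _
            map_smul' := fun c x => hB_smul_left _ _ _ }
        map_add' := fun y y' => by ext x; exact hB_add_right _ _ _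
        map_smul' := fun c y => by ext x; exact hB_smul_right _ _ _ } with hΨ
    have hker : LinearMap.ker Ψ = W₂ := by
      ext y
      simp only [LinearMap.mem_ker, hΨ]
      constructor
      · intro h x hx
        exact LinearMap.congr_fun h ⟨x, hx⟩
      · intro h
        ext ⟨x, hx⟩
        exact h x hx
    have hrank := LinearMap.finrank_range_add_finrank_ker Ψ
    rw [hker] at hrank
    have hrange : Module.finrank ℝ (LinearMap.range Ψ) ≤ Module.finrank ℝ W₁ :=
      (Submodule.finrank_le _).trans (Subspace.dual_finrank_eq).le
    have hsum := Submodule.finrank_sup_add_finrank_inf_eq W₁ W₂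
    rw [hW₁₂, finrank_bot, add_zero] at hsum
    apply Submodule.eq_top_of_finrank_eq
    refine le_antisymm (Submodule.finrank_le _) ?_
    omega
  exact ⟨W₂, hW₂inv, hW₁₂, hW₁₂top⟩

/-! ### An invariant complement modulo `K²` -/

/-- **Complete reducibility modulo `K²`.** Let every closed connected normal subgroup of the compact
Hausdorff group `G` be `⊥` or `⊤`, and let `R` separate points. If `V` is a conjugation-invariant
subspace with `K² ≤ V ≤ K` and `V ≠ K²`, there is a conjugation-invariant `V₂` with
`K² ≤ V₂ ≤ K`, `V + V₂ = K` and `V₂ ≠ K`. Construction: `K = F' + K²` with `F'` finite-dimensional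
invariant (`exists_finiteDimensional_sup_augIdealSq_eq`); on a linear complement `F₁` of
`F₀ = F' ∩ K²` in `F'` the conjugation induces a representation `ρ` with continuous coefficients;
take an invariant complement `W₂` of `W₁ = π₁(V ∩ F')` (`exists_invariant_isCompl`) and
`V₂ = K² + W₂`. [folklore] -/
theorem exists_isConjInvariant_compl [T2Space G]
    (hN : ∀ N : Subgroup G, N.Normal → IsClosed (N : Set G) → IsPreconnected (N : Set G) → N = ⊥ ∨ N = ⊤)
    (hR : (translationFinite G).SeparatesPoints) {V : Submodule ℝ C(G, ℝ)} (hV : IsConjInvariant V)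
    (h2 : augIdealSq G ≤ V) (hK : V ≤ augIdeal G) (hne : V ≠ augIdealSq G) :
    ∃ V₂ : Submodule ℝ C(G, ℝ), IsConjInvariant V₂ ∧ augIdealSq G ≤ V₂ ∧ V₂ ≤ augIdeal G ∧
      V ⊔ V₂ = augIdeal G ∧ V₂ ≠ augIdeal G := by
  classical
  obtain ⟨F', hfd, hF'K, hF'inv, hF'sup⟩ := exists_finiteDimensional_sup_augIdealSq_eq hN hR
  haveI := hfd
  -- `F₀ = F' ∩ K²` and a linear complement `F₁` inside `F'`
  set F₀ : Submodule ℝ F' := (augIdealSq G).comap F'.subtype with hF₀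
  obtain ⟨F₁, hc⟩ := F₀.exists_isCompl
  have hc' : IsCompl F₁ F₀ := hc.symm
  haveI : FiniteDimensional ℝ F₁ := FiniteDimensional.finiteDimensional_submodule F₁
  set π₁ : F' →ₗ[ℝ] F₁ := F₁.projectionOnto F₀ hc' with hπ₁
  have hπ₁F₁ : ∀ x : F₁, π₁ x = x := fun x => Submodule.projectionOnto_apply_left hc' x
  have hπ₁F₀ : ∀ {x : F'}, x ∈ F₀ → π₁ x = 0 := fun hx =>
    (Submodule.projectionOnto_apply_eq_zero_iff hc').mpr hx
  have hsubF₀ : ∀ x : F', x - (π₁ x : F') ∈ F₀ := by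
    intro x
    have h := Submodule.projection_eq_self_sub_projection hc' x
    rw [Submodule.projection_apply] at h
    have h' : x - (π₁ x : F') = (F₀.projectionOnto F₁ hc x : F') := by rw [h]; rfl
    rw [h']
    exact (F₀.projectionOnto F₁ hc x).2
  have hsubK2 : ∀ x : F', ((x : C(G, ℝ)) - ((π₁ x : F') : C(G, ℝ))) ∈ augIdealSq G := fun x => hsubF₀ x
  -- the conjugation on `F'` and the induced action `ρ` on `F₁`
  set κF : G → F' →ₗ[ℝ] F' := fun g => (conjTrans g).toLinearMap.restrict (fun x hx => hF'inv g x hx)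
    with hκF
  have hκF_coe : ∀ (g : G) (x : F'), (κF g x : C(G, ℝ)) = conjTrans g x := fun g x => rfl
  have hκF₀ : ∀ (g : G) {x : F'}, x ∈ F₀ → κF g x ∈ F₀ := fun g x hx => by
    change conjTrans g (x : C(G, ℝ)) ∈ augIdealSq G
    exact isConjInvariant_augIdealSq g _ hx
  set ρ : G → F₁ →ₗ[ℝ] F₁ := fun g => π₁ ∘ₗ κF g ∘ₗ F₁.subtype with hρ
  have hπκ : ∀ (g : G) (x : F'), π₁ (κF g (π₁ x : F')) = π₁ (κF g x) := by
    intro g x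
    have h1 : κF g (π₁ x : F') = κF g x - κF g (x - (π₁ x : F')) := by
      rw [map_sub]; abel
    rw [h1, map_sub, hπ₁F₀ (hκF₀ g (hsubF₀ x))]
    simp
  have hρ_apply : ∀ (g : G) (x : F₁), ρ g x = π₁ (κF g x) := fun g x => rfl
  have hρ_mul : ∀ (g h : G) (x : F₁), ρ h (ρ g x) = ρ (g * h) x := by
    intro g h x
    rw [hρ_apply, hρ_apply, hπκ, hρ_apply]
    congr 1
    apply Subtype.ext
    simp only [hκF_coe, conjTrans_mul]
  have hρ_one : ∀ x : F₁, ρ 1 x = x := by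
    intro x
    rw [hρ_apply]
    have : κF 1 (x : F') = (x : F') := Subtype.ext (by rw [hκF_coe]; exact conjTrans_one _)
    rw [this, hπ₁F₁]
  have hκcont : ∀ x : F', Continuous fun g : G => κF g x := fun x =>
    (continuous_conjTrans_apply (x : C(G, ℝ))).subtype_mk _
  have hρcont : ∀ (L : F₁ →ₗ[ℝ] ℝ) (x : F₁), Continuous fun g : G => L (ρ g x) := by
    intro L x
    have hc1 : Continuous (L ∘ₗ π₁) := LinearMap.continuous_of_finiteDimensional _
    exact hc1.comp (hκcont (x : F'))
  -- the invariant subspace `W₁ = π₁ (V ∩ F')` of `F₁` and an invariant complement `W₂`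
  set W₁ : Submodule ℝ F₁ := (V.comap F'.subtype).map π₁ with hW₁
  have hW₁inv : ∀ (g : G), ∀ x ∈ W₁, ρ g x ∈ W₁ := by
    rintro g _ ⟨v, hv, rfl⟩
    refine ⟨κF g v, ?_, ?_⟩
    · change conjTrans g (v : C(G, ℝ)) ∈ V
      exact hV g _ hv
    · rw [hρ_apply, hπκ]
  obtain ⟨W₂, hW₂inv, hW₁₂, hW₁₂top⟩ :=
    exists_invariant_isCompl (G := G) (E := F₁) ρ hρ_mul hρ_one hρcont W₁ hW₁inv
  -- the complement `V₂ = K² + W₂` (as a subspace of `C(G, ℝ)`)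
  set ι : F₁ →ₗ[ℝ] C(G, ℝ) := F'.subtype ∘ₗ F₁.subtype with hι
  have hι_apply : ∀ y : F₁, ι y = ((y : F') : C(G, ℝ)) := fun y => rfl
  refine ⟨augIdealSq G ⊔ W₂.map ι, ?_, le_sup_left, ?_, ?_, ?_⟩
  · -- conjugation invariance
    intro g v hv
    obtain ⟨k, hk, _, ⟨y, hy, rfl⟩, rfl⟩ := Submodule.mem_sup.mp hv
    rw [map_add]
    refine Submodule.add_mem _ (Submodule.mem_sup_left (isConjInvariant_augIdealSq g k hk)) ?_
    have hsplit : conjTrans g (ι y) = ι (ρ g y) +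
        (((κF g y : F') : C(G, ℝ)) - ((π₁ (κF g y) : F') : C(G, ℝ))) := by
      rw [hι_apply, hι_apply, hρ_apply, hκF_coe]
      abel
    rw [hsplit]
    exact Submodule.add_mem _ (Submodule.mem_sup_right ⟨ρ g y, hW₂inv g y hy, rfl⟩)
      (Submodule.mem_sup_left (hsubK2 _))
  · -- `V₂ ≤ K`
    refine sup_le augIdealSq_le ?_
    rintro _ ⟨y, _, rfl⟩
    exact hF'K (y : F').2
  · -- `V + V₂ = K`
    refine le_antisymm (sup_le hK (sup_le augIdealSq_le ?_)) ?_
    · rintro _ ⟨y, _, rfl⟩; exact hF'K (y : F').2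
    · rw [← hF'sup]
      refine sup_le ?_ (le_sup_right.trans (sup_le_sup_left le_sup_left _))
      intro f hf
      have hπf : (π₁ ⟨f, hf⟩ : F₁) ∈ W₁ ⊔ W₂ := by rw [hW₁₂top]; exact Submodule.mem_top
      obtain ⟨w₁, hw₁, w₂, hw₂, hw⟩ := Submodule.mem_sup.mp hπf
      have hdec : f = ι w₁ + ι w₂ + (f - ((π₁ ⟨f, hf⟩ : F') : C(G, ℝ))) := by
        rw [← map_add, hw, hι_apply]; abel
      rw [hdec]
      refine Submodule.add_mem _ (Submodule.add_mem _ ?_ ?_) ?_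
      · obtain ⟨v, hv, rfl⟩ := hw₁
        have : ι (π₁ v) = (v : C(G, ℝ)) - ((v : C(G, ℝ)) - ((π₁ v : F') : C(G, ℝ))) := by
          rw [hι_apply]; abel
        rw [this]
        exact Submodule.mem_sup_left (V.sub_mem hv (h2 (hsubK2 v)))
      · exact Submodule.mem_sup_right (Submodule.mem_sup_right ⟨w₂, hw₂, rfl⟩)
      · exact Submodule.mem_sup_right (Submodule.mem_sup_left (hsubK2 ⟨f, hf⟩))
  · -- `V₂ ≠ K`: an element of `V \\ K²` is not in `V₂`
    obtain ⟨v, hvV, hvK2⟩ : ∃ v ∈ V, v ∉ augIdealSq G := by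
      by_contra hall
      push Not at hall
      exact hne (le_antisymm hall h2)
    intro hV₂K
    have hvV₂ : v ∈ augIdealSq G ⊔ W₂.map ι := by rw [hV₂K]; exact hK hvV
    obtain ⟨k, hk, _, ⟨w₂, hw₂, rfl⟩, hsum⟩ := Submodule.mem_sup.mp hvV₂
    have hvK : v ∈ F' ⊔ augIdealSq G := by rw [hF'sup]; exact hK hvV
    obtain ⟨f, hf, k', hk', hsum'⟩ := Submodule.mem_sup.mp hvK
    have hfV : f ∈ V := by
      have : f = v - k' := by rw [← hsum']; abel
      rw [this]; exact V.sub_mem hvV (h2 hk')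
    have hdiff : (⟨f, hf⟩ : F') - ((w₂ : F') : F') ∈ F₀ := by
      change (f - ((w₂ : F') : C(G, ℝ))) ∈ augIdealSq G
      have hfk : f - ((w₂ : F') : C(G, ℝ)) = k - k' := by
        have h1 : f + k' = k + ι w₂ := by rw [hsum', hsum]
        rw [hι_apply] at h1
        have h2' : f = k + ((w₂ : F') : C(G, ℝ)) - k' := by rw [← h1]; abel
        rw [h2']; abel
      rw [hfk]
      exact Submodule.sub_mem _ hk hk'
    have hπeq : π₁ ⟨f, hf⟩ = w₂ := by
      have := hπ₁F₀ hdiff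
      rw [map_sub, hπ₁F₁, sub_eq_zero] at this
      exact this
    have hw₂W₁ : w₂ ∈ W₁ := ⟨⟨f, hf⟩, hfV, hπeq⟩
    have hw₂0 : w₂ = 0 := by
      have : w₂ ∈ W₁ ⊓ W₂ := ⟨hw₂W₁, hw₂⟩
      rw [hW₁₂] at this
      exact (Submodule.mem_bot ℝ).mp this
    apply hvK2
    rw [← hsum, hw₂0, map_zero, add_zero]
    exact hk

/-! ### The structure theorem: `K/K²` has no invariant subspaces -/

/-- **Structure theorem (Lie-free form of "the adjoint representation of a simple compact group is
irreducible").** Let `G` be a compact Hausdorff group which is non-abelian, in which every closed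
connected normal subgroup is `⊥` or `⊤`, and whose representative functions separate points. Then
the only conjugation-invariant subspaces `V` with `K² ≤ V ≤ K` are `K²` and `K`. Proof: otherwise
take an invariant complement `V₂` (`exists_isConjInvariant_compl`); the point derivations killing
`V₂`, resp. `V`, form conjugation-stable families `𝔥₁`, `𝔥₂` with `⁅𝔥₁, 𝔥₂⁆ = 0` on `R`
(`IsConjInvariant.bracket_apply_eq_zero`, as `V + V₂ = K`), so the closed connected normal subgroups
`M₁`, `M₂` generated by their flows commute; neither is `⊥` (a derivation separating `K/V`, resp.
`K/V₂`, exists), so both are `⊤` and `G` is abelian — a contradiction. [folklore] -/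
theorem IsConjInvariant.eq_augIdealSq_or_eq_augIdeal [T2Space G]
    (hN : ∀ N : Subgroup G, N.Normal → IsClosed (N : Set G) → IsPreconnected (N : Set G) → N = ⊥ ∨ N = ⊤)
    (hab : ∃ a b : G, a * b ≠ b * a) (hR : (translationFinite G).SeparatesPoints)
    {V : Submodule ℝ C(G, ℝ)} (hV : IsConjInvariant V) (h2 : augIdealSq G ≤ V) (hK : V ≤ augIdeal G) :
    V = augIdealSq G ∨ V = augIdeal G := by
  by_contra h
  push Not at h
  obtain ⟨V₂, hV₂, h2₂, hK₂, hsup, hne₂⟩ := exists_isConjInvariant_compl hN hR hV h2 hK h.1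
  have h₁ := isDerivationFamily_annihilator hV₂
  have h₂ := isDerivationFamily_annihilator hV
  have hVR : V ≤ Subalgebra.toSubmodule (translationFinite G) := hK.trans augIdeal_le
  have hV₂R : V₂ ≤ Subalgebra.toSubmodule (translationFinite G) := hK₂.trans augIdeal_le
  -- the brackets vanish on `R`
  have hbr : ∀ δ₁ ∈ annihilator V₂, ∀ δ₂ ∈ annihilator V, ∀ u ∈ translationFinite G,
      bracket δ₁ δ₂ u = 0 := by
    intro δ₁ h₁' δ₂ h₂' u hu
    have hpd : IsPointDerivation (bracket δ₁ δ₂) := h₁'.1.bracket h₂'.1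
    refine hpd.apply_eq_zero_of_forall_augIdeal (fun c hc => ?_) hu
    rw [← hsup] at hc
    obtain ⟨v, hv, v₂, hv₂, rfl⟩ := Submodule.mem_sup.mp hc
    rw [map_add, hV.bracket_apply_eq_zero hVR h₁'.1 hR h₂'.2 hv, zero_add,
      bracket_swap δ₂ δ₁ (hV₂R hv₂), hV₂.bracket_apply_eq_zero hV₂R h₂'.1 hR h₁'.2 hv₂, neg_zero]
  -- both generated subgroups are `⊤`
  haveI := normal_flowSubgroup h₁ hR
  haveI := normal_flowSubgroup h₂ hR
  have hM₂ : flowSubgroup (annihilator V) = ⊤ := by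
    rcases hN _ inferInstance (isClosed_flowSubgroup _) (isPreconnected_flowSubgroup h₂ hR) with hbot | htop
    · exfalso
      obtain ⟨δ, hδ, hδV, u, hu, hδu⟩ := exists_isPointDerivation_of_lt h2 (lt_of_le_of_ne hK h.2)
      exact hδu (apply_eq_zero_of_flowSubgroup_eq_bot h₂ hbot ⟨hδ, hδV⟩ hu)
    · exact htop
  have hM₁ : flowSubgroup (annihilator V₂) = ⊤ := by
    rcases hN _ inferInstance (isClosed_flowSubgroup _) (isPreconnected_flowSubgroup h₁ hR) with hbot | htop
    · exfalso
      obtain ⟨δ, hδ, hδV, u, hu, hδu⟩ := exists_isPointDerivation_of_lt h2₂ (lt_of_le_of_ne hK₂ hne₂)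
      exact hδu (apply_eq_zero_of_flowSubgroup_eq_bot h₁ hbot ⟨hδ, hδV⟩ hu)
    · exact htop
  obtain ⟨a, b, hab⟩ := hab
  exact hab (commute_of_bracket_eq_zero h₁ h₂ hR hbr (by rw [hM₁]; trivial) (by rw [hM₂]; trivial))

end Reducibility

end Literature.RepresentationTheory.CompactGroups
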